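import Literature.NumberTheory.NumberFields.ClassGroupNormRange
import Literature.NumberTheory.NumberFields.HilbertClassFieldArtinEquivariance
import Literature.NumberTheory.NumberFields.HilbertClassFieldOfGaloisExtension
import Mathlib.FieldTheory.Galois.Abelian
import HarnessLib

/-!
# Herbrand's direction via Stickelberger, part D (class field theory): for `E ⊆ M` with `M/ℚ` ABELIAN, the norm
# cokernel `Cl(E)/N_{M/E} Cl(M)` is fixed by `Gal(E/ℚ)`

Crux `stmt-BirchSwinnertonDyer-20372` (`PrintCFram.BottomClassIndexLawFiveLe`), line `eisenstein-resource-bdp-line`; part of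
the discharge of the HERBRAND direction of `MazurWiles1984.thm2_*` (parts A–C: `…HerbrandStickelberger{BernoulliSum,
NormPushdown,EigenAlgebra}.lean`). THEOREM ONLY (no definition, no named fact, no `sorry`), unconditional — the inputs are the
tree's PROVED class field theory: the Artin isomorphism of the Hilbert class field and the norm-range theorem
`range_classGroupNorm_eq` («`N_{M/E}(Cl_M) = artinEquiv⁻¹ Gal(H_E / M ∩ H_E)`», Lang Ch. 3 §4 Lemma / Washington Thm. 10.1),
its equivariance `artinEquiv_mulEquiv_intAut_apply` («`(H/E, σ𝔞) = τ̃ (H/E, 𝔞) τ̃⁻¹`», Neukirch IV §6 / VI (7.1)), and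
`hilbertClassField.isGalois_of_isGalois` (`H_E/ℚ` is Galois).

* **`mulEquiv_mul_inv_mem_range_classGroupNorm`** — `E ⊆ M` number fields, `E/ℚ` and `M/ℚ` Galois, `M/ℚ` ABELIAN: for every
  `σ ∈ Gal(E/ℚ)` and every ideal class `c` of `E`, `(σ • c)·c⁻¹ ∈ N_{M/E}(Cl_M)`. PROOF: by the range theorem it suffices that
  `artinEquiv((σ•c)c⁻¹) = τ̃ φ τ̃⁻¹ φ⁻¹` (`φ = artinEquiv c`, `τ̃ ∈ Gal(H_E/ℚ)` a lift of `σ`) fixes `F = H_E ∩ M`; but `F` embeds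
  into `M` over `ℚ`, so `F/ℚ` is Galois with ABELIAN group, `τ̃` and `φ` preserve `F` and commute on it. This is the
  classical remark that for an abelian field the genus-type quotient `Cl_E / N Cl_M ≅ Gal((H_E ∩ M)/E)` carries the trivial
  action of `Gal(E/ℚ)` (conjugation inside the abelian group `Gal(M/ℚ)`), the class-field-theoretic step in the proof of
  Stickelberger's theorem for a general abelian field (Washington Thm. 6.10: passage from `ℚ(ζ_m)` to `K ⊆ ℚ(ζ_m)`).

BSD is not proved by any of this; no summit statement is proved here.
References: [Lang1990] Ch. 3 §4 (Lemma to Thm. 4.3); [Washington1997] Thm. 10.1, Thm. 6.10; [NeukirchANT1999] IV §6, VI (7.1).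
-/

noncomputable section

open NumberField IsDedekindDomain Field
open scoped nonZeroDivisors IsMulCommutative
open Literature.NumberTheory.NumberFields Literature.NumberTheory.NumberFields.AmbiguousClass
open Literature.NumberTheory.GaloisRepresentations

set_option linter.dupNamespace false
set_option autoImplicit false

namespace Summit.BirchSwinnertonDyer.BirchSwinnertonDyer.Theorems.PrintCFram.HerbrandStickelberger

/-- Two `ℚ`-automorphisms of a field `H` commute on an intermediate field `F` which is GALOIS WITH ABELIAN GROUP over `ℚ`
(both restrict to `Gal(F/ℚ)`, which is commutative). [folklore] -/
theorem apply_apply_comm_of_mem {H : Type*} [Field H] [Algebra ℚ H] (F : IntermediateField ℚ H) [IsAbelianGalois ℚ F]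
    (α β : H ≃ₐ[ℚ] H) {x : H} (hx : x ∈ F) : α (β x) = β (α x) := by
  have hc : α.restrictNormal F * β.restrictNormal F = β.restrictNormal F * α.restrictNormal F :=
    IsMulCommutative.is_comm.comm _ _
  have h := congrArg (fun γ : F ≃ₐ[ℚ] F => (algebraMap F H) (γ ⟨x, hx⟩)) hc
  simp only [AlgEquiv.mul_apply, AlgEquiv.restrictNormal_commutes] at h
  exact h

/-- Elements of `Gal(H/ℚ)` preserve every intermediate field `F` which is Galois (with abelian group) over `ℚ`
(they restrict to `F`, `AlgEquiv.restrictNormal`). [folklore] -/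
theorem apply_mem_of_isAbelianGalois {H : Type*} [Field H] [Algebra ℚ H] (F : IntermediateField ℚ H)
    [IsAbelianGalois ℚ F] (γ : H ≃ₐ[ℚ] H) {x : H} (hx : x ∈ F) : γ x ∈ F := by
  have h := AlgEquiv.restrictNormal_commutes γ F ⟨x, hx⟩
  change ((γ.restrictNormal F ⟨x, hx⟩ : F) : H) = γ x at h
  rw [← h]
  exact (γ.restrictNormal F ⟨x, hx⟩).2

/-- **The norm cokernel of an abelian field is fixed by `Gal(E/ℚ)`.** Let `E ⊆ M` be number fields, both Galois over `ℚ`,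
with `Gal(M/ℚ)` ABELIAN. Then for every `σ ∈ Gal(E/ℚ)` and every ideal class `c` of `E`, `(σ • c)·c⁻¹` is a norm from `M`:
`(σ • c)·c⁻¹ ∈ N_{M/E}(Cl(𝓞 M))` (`σ` acting by `ClassGroup.mulEquiv (AmbiguousClass.intAut σ)`). Class field theory: by the
range theorem `N_{M/E}(Cl_M) = artinEquiv⁻¹ Gal(H_E/(H_E ∩ M))` it suffices that `artinEquiv((σ•c)c⁻¹) = τ̃φτ̃⁻¹φ⁻¹`
(`φ = artinEquiv c`, `τ̃` a lift of `σ` to the Galois extension `H_E/ℚ`) fixes `F = H_E ∩ M`; and `F` embeds into `M`, so it is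
Galois over `ℚ` with abelian group, is preserved by `τ̃` and `φ`, and these commute on it.
[cite: Lang1990, Ch. 3 §4 (Lemma: the norm map and the Hilbert class field)] [cite: Washington1997, Thm. 10.1 and Thm. 6.10 (proof)]
[cite: NeukirchANT1999, Ch. IV §6 and Ch. VI §7 (7.1) (functoriality of the Artin symbol)] -/
theorem mulEquiv_mul_inv_mem_range_classGroupNorm (E M : Type) [Field E] [NumberField E] [Field M] [NumberField M]
    [Algebra E M] [IsGalois ℚ E] [IsAbelianGalois ℚ M] [IsScalarTower ℚ E M]
    (σ : E ≃ₐ[ℚ] E) (c : ClassGroup (𝓞 E)) :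
    ClassGroup.mulEquiv (intAut σ) c * c⁻¹ ∈ (classGroupNorm E M).range := by
  classical
  haveI : Module.Finite E M := Module.Finite.of_restrictScalars_finite ℚ E M
  haveI : Algebra.IsAlgebraic E M := Algebra.IsAlgebraic.of_finite E M
  -- the ambient Galois extension `Ω ⊆ Ē` of `E`: the normal closure of `H · M₀` (tree construction)
  let H : IntermediateField E (AlgebraicClosure E) := hilbertClassField E
  let ι : M →ₐ[E] AlgebraicClosure E := IsAlgClosed.lift
  let L₀ : IntermediateField E (AlgebraicClosure E) := ι.fieldRange
  let eL : M ≃ₐ[E] L₀ := AlgEquiv.ofInjectiveField ι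
  haveI : FiniteDimensional E L₀ := LinearEquiv.finiteDimensional eL.toLinearEquiv
  let C : IntermediateField E (AlgebraicClosure E) := H ⊔ L₀
  haveI : FiniteDimensional E C := IntermediateField.finiteDimensional_sup H L₀
  let Ω : IntermediateField E (AlgebraicClosure E) :=
    IntermediateField.normalClosure E C (AlgebraicClosure E)
  haveI : NumberField Ω := NumberField.of_module_finite E Ω
  have hCE : C ≤ Ω := IntermediateField.le_normalClosure C
  have hHE : H ≤ Ω := le_sup_left.trans hCE
  have hLE : L₀ ≤ Ω := le_sup_right.trans hCE
  let jH : H →ₐ[E] Ω := IntermediateField.inclusion hHE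
  let jL : M →ₐ[E] Ω := (IntermediateField.inclusion hLE).comp eL.toAlgHom
  letI : Algebra H Ω := jH.toRingHom.toAlgebra
  letI : Algebra M Ω := jL.toRingHom.toAlgebra
  haveI : IsScalarTower E H Ω := IsScalarTower.of_algebraMap_eq fun x => (jH.commutes x).symm
  haveI : IsScalarTower E M Ω := IsScalarTower.of_algebraMap_eq fun x => (jL.commutes x).symm
  -- the range theorem inside `Ω`
  have hrange := range_classGroupNorm_eq E M Ω
  have hH : IsScalarTower.toAlgHom E H Ω = jH := AlgHom.ext fun _ => rfl
  have hL' : IsScalarTower.toAlgHom E M Ω = jL := AlgHom.ext fun _ => rfl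
  rw [hH, hL'] at hrange
  rw [hrange, Subgroup.mem_comap, MulEquiv.coe_toMonoidHom, map_mul, map_inv,
    IntermediateField.mem_fixingSubgroup_iff]
  intro x hx
  -- `F₁ = H ∩ M` (pulled back to `H`), as an intermediate field of `H/ℚ`; it embeds into `M` over `ℚ`, hence is
  -- Galois over `ℚ` with abelian group
  haveI hEH : IsScalarTower ℚ E H :=
    IsScalarTower.of_algebraMap_eq fun y => Subtype.ext (IsScalarTower.algebraMap_apply ℚ E (AlgebraicClosure E) y)
  haveI : IsGalois ℚ H := hilbertClassField.isGalois_of_isGalois (K := ℚ) E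
  haveI : IsScalarTower ℚ E Ω :=
    IsScalarTower.of_algebraMap_eq fun y => Subtype.ext (IsScalarTower.algebraMap_apply ℚ E (AlgebraicClosure E) y)
  haveI : IsScalarTower ℚ H Ω := IsScalarTower.of_algebraMap_eq fun q => by
    change algebraMap ℚ Ω q = jH (algebraMap ℚ H q)
    rw [IsScalarTower.algebraMap_apply ℚ E H q, jH.commutes, ← IsScalarTower.algebraMap_apply ℚ E Ω q]
  haveI : IsScalarTower ℚ M Ω := IsScalarTower.of_algebraMap_eq fun q => by
    change algebraMap ℚ Ω q = jL (algebraMap ℚ M q)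
    rw [IsScalarTower.algebraMap_apply ℚ E M q, jL.commutes, ← IsScalarTower.algebraMap_apply ℚ E Ω q]
  let jH' : H →ₐ[ℚ] Ω := jH.restrictScalars ℚ
  let jL' : M →ₐ[ℚ] Ω := jL.restrictScalars ℚ
  set F₁' : IntermediateField ℚ H := (jL'.fieldRange).comap jH' with hF₁'
  have hmem : ∀ y : F₁', (jH' (y : H) : Ω) ∈ jL'.range := fun y => by
    have hy : jH' (y : H) ∈ jL'.fieldRange := y.2
    obtain ⟨m, hm⟩ := AlgHom.mem_fieldRange.mp hy
    exact ⟨m, hm⟩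
  let fI : F₁' →ₐ[ℚ] jL'.range := (jH'.comp F₁'.val).codRestrict jL'.range hmem
  let f : F₁' →ₐ[ℚ] M := (AlgEquiv.ofInjectiveField jL').symm.toAlgHom.comp fI
  haveI : IsAbelianGalois ℚ F₁' := IsAbelianGalois.of_algHom f
  -- lift `σ` to `τ ∈ Gal(H/ℚ)`
  obtain ⟨τ, hτ⟩ := AlgEquiv.restrictNormalHom_surjective (F := ℚ) (E := H) (K₁ := E) σ
  have hτ' : ∀ y : E, τ (algebraMap E H y) = algebraMap E H (σ y) := fun y => by
    rw [← hτ]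
    exact (AlgEquiv.restrictNormal_commutes τ E y).symm
  rw [AlgEquiv.mul_apply, hilbertClassField.artinEquiv_mulEquiv_intAut_apply E τ σ hτ' c]
  -- `φ = artinEquiv c` and `τ` preserve `F₁'` and commute on it
  set φ : H ≃ₐ[E] H := hilbertClassField.artinEquiv E c with hφ
  have hx' : x ∈ F₁' := hx
  have h1 : (φ⁻¹ : H ≃ₐ[E] H) x ∈ F₁' := by
    have := apply_mem_of_isAbelianGalois F₁' ((φ⁻¹ : H ≃ₐ[E] H).restrictScalars ℚ) hx'
    simpa using this
  have h2 : τ.symm ((φ⁻¹ : H ≃ₐ[E] H) x) ∈ F₁' := by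
    have := apply_mem_of_isAbelianGalois F₁' τ⁻¹ h1
    simpa using this
  have hcomm := apply_apply_comm_of_mem F₁' τ (φ.restrictScalars ℚ) h2
  rw [AlgEquiv.restrictScalars_apply, AlgEquiv.restrictScalars_apply, AlgEquiv.apply_symm_apply] at hcomm
  rw [hcomm, show φ ((φ⁻¹ : H ≃ₐ[E] H) x) = (φ * φ⁻¹) x from rfl, mul_inv_cancel, AlgEquiv.one_apply]


end Summit.BirchSwinnertonDyer.BirchSwinnertonDyer.Theorems.PrintCFram.HerbrandStickelberger

end
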